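import Summits.ResolutionOfSingularities.ResolutionOfSingularities.Theorems.FrobeniusLadderFInjectiveMacaulayficationDominatingLocFixLocalSupported
import Summits.ResolutionOfSingularities.ResolutionOfSingularities.Theorems.FrobeniusLadderFInjectiveMacaulayficationClusterGrowthStep
import Literature.AlgebraicGeometry.Resolution.StalkIdealGenerization
import Literature.AlgebraicGeometry.Resolution.BlowupsFlatBaseChange
import HarnessLib

/-!
# (b3) The support clause threaded to `X₁` — `(I_T)_ζ ≤ √(c)` for `T ⊇ Sing X₁ ∪ NonPrinc J₀` — and the CLUSTER-GROWTH STEP at a residual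
# point of local dimension three with NO local hypothesis left
# (crux `FInjectiveMacaulayfication` stmt-ResolutionOfSingularities-15315, chain w45a; res-L1-w45a-plan-1 RULING R16.47 (1) «(b3) … thread it to the local
# form `stalkIdeal (vanishingIdeal T) ζ ≤ (span c).radical` for T := closure of (regularLocus X₁)ᶜ ∪ NonInv(J₀) — this is the `hrad` that feeds …
# lead-1's `clusterGrowth_step`, and it makes T a STABLE ARENA»; seat res-L1-w45a-stub-1 g6)

[OURS · L1 W4.5a] Support file (`--supports stmt-ResolutionOfSingularities-15315 --as helper`); NOT a statement of any manuscript; def-free;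
THEOREMS modulo `CossartPiltant2019General` + `Stacks081R` + `CossartPiltant2019Principalization` (+ `NonFullLocusClosed` for the step) BY
NAME; AI-written (AI review is weaker than expert review).

* `hrad_of_support_clause`: the generization dictionary (Stacks 01J7). If every prime `P ⊇ (c)` of `𝒪_{X₁,ζ}` has `(𝒪_ζ)_P` non-regular or
  `J₀,ζ (𝒪_ζ)_P` non-principal (the ring-level clause of `DominatingLocFixLocalSupported.exists_productCompatible_locFix_dimThree_supported`),
  then for every closed `T ⊇ (Reg X₁)ᶜ ∪ {y | ¬ IsLocallyPrincipalAt J₀ y}`: `(I_T)_ζ ≤ √(c)`. Proof: `√(c) = ⋂ {P ⊇ (c)}`; a prime `P`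
  of `𝒪_ζ` is a generization `y = η_P ⤳ ζ` (`X₁.fromSpecStalk ζ`) with `𝒪_{X₁,y} = (𝒪_ζ)_P` (`isLocalizationAtPrime_stalk_fromSpecStalk`;
  regularity read through the flat preimmersion `Spec 𝒪_ζ → X₁`) and `J₀,y = J₀,ζ 𝒪_y` (`stalkIdeal_map_stalkSpecializes`), so `y ∈ T`, and
  `(I_T)_ζ ≤ P ↔ y ∈ supp I_T = T` (`mem_support_iff_stalkIdeal_le_primeOfSpecializes`).
* `exists_productCompatible_locFix_dimThree_hrad (hG h081R hP)`: (b2) + (b3) packaged — `c, d` at `ζ` of local dimension `3` with the charts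
  of `Bl_{J₀,ζ·(c)}` REGULAR and FULL at every prime AND `(I_T)_ζ ≤ √(c)` for every closed `T ⊇ Sing X₁ ∪ NonPrinc J₀`.
* `clusterGrowth_step_dimThree (hG h081R hP hNF)`: res-L1-w45a-lead-1's `ClusterGrowthStep.clusterGrowth_step` with its local inputs
  DISCHARGED at a point `ζ` of local dimension `3`: for `J₀ ≠ ⊥` good over `S` and any closed `T ⊇ Sing X₁ ∪ NonPrinc J₀` (the STABLE
  ARENA) there are `J″ ≠ ⊥` with `supp J″ ⊆ T` and an open `U ∋ ζ` with every blowing up along `J₀ · J″` FULL over `U` and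
  `GoodOver p X₁ (J₀ · J″) ((S ∖ T) ∪ U)`. (+ `_of_named` from the five printed theorems.)
[cite: StacksProject, Tag 01J7; Tag 0804] [cite: CossartPiltant2019, Thm. 1.1 (i)(ii); Prop. 4.4] [cite: DattaMurayama2024, Thm. B]
-/

-- single-problem summit: the doubled namespace component is forced
set_option linter.dupNamespace false

noncomputable section

namespace Summit.ResolutionOfSingularities.ResolutionOfSingularities.Theorems.FInjectiveMacaulayfication.ClusterGrowthStepDimThree

open CategoryTheory CategoryTheory.Limits AlgebraicGeometry TopologicalSpace IsLocalRing
open Literature.AlgebraicGeometry.Resolution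
open Summit.ResolutionOfSingularities.ResolutionOfSingularities.Theorems.FInjectiveMacaulayfication
open SliceableCentre FCUnguardedAprime
open Scheme.IdealSheafData

/-! ## §1 (b3) The generization dictionary: ring-level support clause ⇒ `(I_T)_ζ ≤ √(c)` -/

/-- **(b3) `(I_T)_ζ ≤ √(c)`** from the ring-level clause «every prime `P ⊇ (c)` of `𝒪_ζ` has `(𝒪_ζ)_P` non-regular or `J₀,ζ (𝒪_ζ)_P`
non-principal», for every closed `T ⊇ (Reg X₁)ᶜ ∪ NonPrinc J₀`. [folklore; cite: StacksProject, Tag 01J7] -/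
theorem hrad_of_support_clause {X₁ : Scheme.{0}} [IsLocallyNoetherian X₁] (ζ : X₁) (J₀ : X₁.IdealSheafData)
    {m : ℕ} (c : Fin m → X₁.presheaf.stalk ζ)
    (hV : ∀ P : PrimeSpectrum (X₁.presheaf.stalk ζ), Ideal.span (Set.range c) ≤ P.asIdeal →
      ¬ IsRegularLocalRing (Localization.AtPrime P.asIdeal) ∨
      ¬ ((stalkIdeal J₀ ζ).map (algebraMap (X₁.presheaf.stalk ζ) (Localization.AtPrime P.asIdeal))).IsPrincipal)
    (T : Set X₁) (hT : IsClosed T) (hsub : (Scheme.regularLocus X₁)ᶜ ∪ {y | ¬ IsLocallyPrincipalAt J₀ y} ⊆ T) :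
    stalkIdeal (vanishingIdeal ⟨T, hT⟩) ζ ≤ (Ideal.span (Set.range c)).radical := by
  classical
  rw [Ideal.radical_eq_sInf]
  refine le_sInf fun P hP => ?_
  obtain ⟨hcP, hPprime⟩ := hP
  haveI := hPprime
  let q : PrimeSpectrum (X₁.presheaf.stalk ζ) := ⟨P, hPprime⟩
  -- the generization `y = η_q ⤳ ζ`
  let y : X₁ := X₁.fromSpecStalk ζ q
  have hy : y ⤳ ζ := fromSpecStalk_specializes q
  -- `(I_T)_ζ ≤ P ↔ y ∈ T`
  have key : y ∈ (vanishingIdeal ⟨T, hT⟩ : X₁.IdealSheafData).support ↔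
      stalkIdeal (vanishingIdeal ⟨T, hT⟩ : X₁.IdealSheafData) ζ ≤ q.asIdeal := by
    have h1 := mem_support_iff_stalkIdeal_le_primeOfSpecializes hy (vanishingIdeal ⟨T, hT⟩ : X₁.IdealSheafData)
    rwa [primeOfSpecializes_fromSpecStalk] at h1
  have hyT : y ∈ T → stalkIdeal (vanishingIdeal ⟨T, hT⟩ : X₁.IdealSheafData) ζ ≤ P := fun hyT => by
    have hmem : y ∈ ((vanishingIdeal ⟨T, hT⟩ : X₁.IdealSheafData).support : Set X₁) := by
      rw [Scheme.IdealSheafData.coe_support_vanishingIdeal]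
      exact hyT
    exact key.mp hmem
  apply hyT
  apply hsub
  rcases hV q hcP with h | h
  · -- `(𝒪_ζ)_P = 𝒪_{X₁,y}` non-regular ⇒ `y ∉ Reg X₁`
    refine Or.inl fun hyreg => h ?_
    haveI := flat_fromSpecStalk X₁ ζ
    have hq : q ∈ Scheme.regularLocus (Spec (X₁.presheaf.stalk ζ)) :=
      (mem_regularLocus_iff_of_flat_of_isPreimmersion (X₁.fromSpecStalk ζ) q).mpr hyreg
    have hq' : IsRegularLocalRing ((Spec (X₁.presheaf.stalk ζ)).presheaf.stalk q) := hq
    haveI := hq'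
    exact IsRegularLocalRing.of_ringEquiv (Spec.stalkIso (X₁.presheaf.stalk ζ) q).commRingCatIsoToRingEquiv
  · -- `J₀,ζ (𝒪_ζ)_P = J₀,y` non-principal ⇒ `J₀` not locally principal at `y`
    refine Or.inr fun hlp => h ?_
    have hpr : (stalkIdeal J₀ y).IsPrincipal := hlp.isPrincipal_stalkIdeal
    letI := (X₁.presheaf.stalkSpecializes hy).hom.toAlgebra
    haveI : IsLocalization.AtPrime (X₁.presheaf.stalk y) q.asIdeal := isLocalizationAtPrime_stalk_fromSpecStalk q
    let e : X₁.presheaf.stalk y ≃ₐ[X₁.presheaf.stalk ζ] Localization.AtPrime q.asIdeal :=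
      IsLocalization.algEquiv q.asIdeal.primeCompl _ _
    have hcomp : (e : X₁.presheaf.stalk y →+* Localization.AtPrime q.asIdeal).comp (X₁.presheaf.stalkSpecializes hy).hom =
        algebraMap (X₁.presheaf.stalk ζ) (Localization.AtPrime q.asIdeal) :=
      RingHom.ext fun r => e.commutes r
    have h2 : (stalkIdeal J₀ ζ).map (algebraMap (X₁.presheaf.stalk ζ) (Localization.AtPrime q.asIdeal)) =
        (stalkIdeal J₀ y).map (e : X₁.presheaf.stalk y →+* Localization.AtPrime q.asIdeal) := by
      rw [← stalkIdeal_map_stalkSpecializes J₀ hy, Ideal.map_map, hcomp]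
    rw [h2]
    exact DominatingLocFixLocalSupported.isPrincipal_map _ hpr

/-! ## §2 (b2)+(b3) packaged, and the cluster-growth step at local dimension three -/

/-- **(b2)+(b3): the product-compatible regular local fix at `dim 𝒪_ζ = 3` with the `X₁`-level support clause** `(I_T)_ζ ≤ √(c)` for every
closed `T ⊇ Sing X₁ ∪ NonPrinc J₀`. [OURS · conditional-result] [cite: CossartPiltant2019, Thm. 1.1 (i)(ii); Prop. 4.4] [cite: StacksProject, Tag 01J7] -/
theorem exists_productCompatible_locFix_dimThree_hrad
    (hG : CossartPiltant2019General.{0}) (h081R : Stacks081R.{0}) (hP : CossartPiltant2019Principalization.{0})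
    (p : ℕ) [Fact p.Prime] {k : Type} [Field k] [CharP k p] {X₁ : Scheme.{0}} (f₁ : X₁ ⟶ Spec (.of k))
    [LocallyOfFiniteType f₁] [IsIntegral X₁]
    (ζ : X₁) (hdim : ringKrullDim (X₁.presheaf.stalk ζ) = 3) (J₀ : X₁.IdealSheafData) (hJ₀ : J₀ ≠ ⊥) :
    ∃ (m : ℕ) (c : Fin m → X₁.presheaf.stalk ζ) (n : ℕ) (d : Fin n → X₁.presheaf.stalk ζ),
      Ideal.span (Set.range c) ≠ ⊥ ∧ Ideal.span (Set.range d) = stalkIdeal J₀ ζ * Ideal.span (Set.range c) ∧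
      (∀ (j : Fin n) (𝔔 : PrimeSpectrum (blowupAlgebra (Ideal.span (Set.range d)) (d j))),
        IsRegularLocalRing (Localization.AtPrime 𝔔.asIdeal) ∧ FullCl p (Localization.AtPrime 𝔔.asIdeal)) ∧
      ∀ (T : Set X₁) (hT : IsClosed T), (Scheme.regularLocus X₁)ᶜ ∪ {y | ¬ IsLocallyPrincipalAt J₀ y} ⊆ T →
        stalkIdeal (vanishingIdeal ⟨T, hT⟩) ζ ≤ (Ideal.span (Set.range c)).radical := by
  haveI : IsLocallyNoetherian X₁ := LocallyOfFiniteType.isLocallyNoetherian f₁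
  obtain ⟨m, c, n, d, hc0, hd, hfull, hV⟩ :=
    DominatingLocFixLocalSupported.exists_productCompatible_locFix_dimThree_supported hG h081R hP p f₁ ζ hdim J₀ hJ₀
  exact ⟨m, c, n, d, hc0, hd, hfull, fun T hT hsub => hrad_of_support_clause ζ J₀ c hV T hT hsub⟩

/-- **CLUSTER-GROWTH STEP AT A RESIDUAL POINT OF LOCAL DIMENSION THREE, local inputs discharged** (Cossart–Piltant): for `J₀ ≠ ⊥` good over
`S`, `ζ` with `dim 𝒪_{X₁,ζ} = 3`, and any closed STABLE ARENA `T ⊇ Sing X₁ ∪ NonPrinc J₀`, there are `J″ ≠ ⊥` with `supp J″ ⊆ T` and an open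
`U ∋ ζ` such that every blowing up along `J₀ · J″` is FULL over `U` and `J₀ · J″` is good over `(S ∖ T) ∪ U`. [OURS · conditional-result]
[cite: CossartPiltant2019, Thm. 1.1 (i)(ii); Prop. 4.4] [cite: DattaMurayama2024, Thm. B] [cite: StacksProject, Tag 01J7; Tag 0804] -/
theorem clusterGrowth_step_dimThree
    (hG : CossartPiltant2019General.{0}) (h081R : Stacks081R.{0}) (hP : CossartPiltant2019Principalization.{0})
    (hNF : NonFullLocusClosed.NonFullLocusClosed)
    (p : ℕ) (hp : p.Prime) (k : Type) [Field k] [CharP k p] (X₁ : Scheme.{0}) (f₁ : X₁ ⟶ Spec (.of k))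
    [LocallyOfFiniteType f₁] [QuasiCompact f₁] [IsIntegral X₁]
    (J₀ : X₁.IdealSheafData) (hJ₀ : J₀ ≠ ⊥) (S : Set X₁) (hS : GoodOver p X₁ J₀ S)
    (ζ : X₁) (hdim : ringKrullDim (X₁.presheaf.stalk ζ) = 3)
    (T : Set X₁) (hT : IsClosed T) (hsub : (Scheme.regularLocus X₁)ᶜ ∪ {y | ¬ IsLocallyPrincipalAt J₀ y} ⊆ T) :
    ∃ (J'' : X₁.IdealSheafData) (U : X₁.Opens), J'' ≠ ⊥ ∧ (J''.support : Set X₁) ⊆ T ∧ ζ ∈ (U : Set X₁) ∧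
      (∀ (X₂ : Scheme.{0}) (π : X₂ ⟶ X₁), IsBlowup π (J₀ * J'') → ∀ x : X₂, π.base x ∈ (U : Set X₁) → FullCl p (X₂.presheaf.stalk x)) ∧
      GoodOver p X₁ (J₀ * J'') ((S \ T) ∪ (U : Set X₁)) := by
  haveI : Fact p.Prime := ⟨hp⟩
  obtain ⟨m, c, n, d, hc0, hd, hfull, hrad⟩ := exists_productCompatible_locFix_dimThree_hrad hG h081R hP p f₁ ζ hdim J₀ hJ₀
  obtain ⟨J'', U, hJ'', -, hJ''T, hζU, hU, hgood⟩ :=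
    ClusterGrowthStep.clusterGrowth_step hNF p hp k X₁ f₁ J₀ hJ₀ S hS ζ c hc0 d hd (fun j 𝔔 _ => (hfull j 𝔔).2) T hT
      (hrad T hT hsub)
  exact ⟨J'', U, hJ'', hJ''T, hζU, hU, hgood⟩

/-- The cluster-growth step at local dimension three from the FIVE printed theorems BY NAME (CP 2019 Thm. 1.1; Raynaud–Gruson 1971 Thm. 5.2.2;
CP 2019 Prop. 4.4; Datta–Murayama 2024 Thm. B; EGA IV₂ 6.11.2). [OURS · conditional-result] -/
theorem clusterGrowth_step_dimThree_of_named
    (hG : CossartPiltant2019General.{0}) (h081R : Stacks081R.{0}) (hP : CossartPiltant2019Principalization.{0})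
    (hDM : Literature.AlgebraicGeometry.Resolution.DattaMurayama2024_fInjectiveLocusOpen.{0})
    (hCMo : NonFullLocusClosed.CMLocusOpen)
    (p : ℕ) (hp : p.Prime) (k : Type) [Field k] [CharP k p] (X₁ : Scheme.{0}) (f₁ : X₁ ⟶ Spec (.of k))
    [LocallyOfFiniteType f₁] [QuasiCompact f₁] [IsIntegral X₁]
    (J₀ : X₁.IdealSheafData) (hJ₀ : J₀ ≠ ⊥) (S : Set X₁) (hS : GoodOver p X₁ J₀ S)
    (ζ : X₁) (hdim : ringKrullDim (X₁.presheaf.stalk ζ) = 3)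
    (T : Set X₁) (hT : IsClosed T) (hsub : (Scheme.regularLocus X₁)ᶜ ∪ {y | ¬ IsLocallyPrincipalAt J₀ y} ⊆ T) :
    ∃ (J'' : X₁.IdealSheafData) (U : X₁.Opens), J'' ≠ ⊥ ∧ (J''.support : Set X₁) ⊆ T ∧ ζ ∈ (U : Set X₁) ∧
      (∀ (X₂ : Scheme.{0}) (π : X₂ ⟶ X₁), IsBlowup π (J₀ * J'') → ∀ x : X₂, π.base x ∈ (U : Set X₁) → FullCl p (X₂.presheaf.stalk x)) ∧
      GoodOver p X₁ (J₀ * J'') ((S \ T) ∪ (U : Set X₁)) :=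
  clusterGrowth_step_dimThree hG h081R hP (NonFullLocusClosed.nonFullLocusClosed_of_named hDM hCMo) p hp k X₁ f₁ J₀ hJ₀ S hS ζ hdim T hT hsub

end Summit.ResolutionOfSingularities.ResolutionOfSingularities.Theorems.FInjectiveMacaulayfication.ClusterGrowthStepDimThree

end
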